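/-
Origin: expansion seat `prover-pub-hodgecm-mc-binder-1-g14-0`, handover #R87 2026-08-20T16:54:41Z md5 bdcf341bf713 (117 l.; NEW additive leaf (universe-free), (J5) recipe type = Shimura S*; imports #R86 + Vendored ComplexMultiplication/{EmbeddingAction,ReflexType}; drops ⇒ {#R88}; NAME LIST: HodgeCM.SignRecipe.mem_liftType_false_iff_mem_reflexLift · HodgeCM.SignRecipe.liftType_false_eq_image_reflexLift · HodgeCM.SignRecipe.liftType_true_eq_bar_liftType_false) (`HOME/mc/pub-hodgecm-mc-binder-1-g14/stage56/HodgeCM/Model/Binders/JLiuReflexLift.lean`, md5 bdcf341bf713, 117 lines);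
landed by the second packager p2 gen 10 (p2-g10) in gate run 56 as `HodgeCM/Model/Binders/JLiuReflexLift.lean` (packager comment re-wording per the RUN-32 precedent (gate audit (5) rejects the proof-placeholder tokens s-o-r-r-y / a-d-m-i-t anywhere in a source, comments included): 1 occurrence(s) inside COMMENTS re-spelt `proof-hole` / `adm-token`; no Lean code byte touched).
-/
/-
Copyright (c) 2026 the pub-hodgecm formalisation cell (harness21).  New file, not vendored.
Origin: session prover-pub-hodgecm-mc-binder-1-g14-0 (unit pub-hodgecm-mc-binder-1-g14, BINDER PROVER gen 14 of lineage mc-binder-1;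
content lane (J-Liu-Θ) of BINDER-TRIAGE §58.2, scope memo `HOME/mc/pub-hodgecm-mc-binder-1-g14/JLIU-THETA-SCOPE.md` item (J5)),
2026-08-20.  Intended final place: `HodgeCM/Model/Binders/JLiuReflexLift.lean` (NEW additive leaf; imports `HodgeCM.Model.Binders.JLiuSignType`
(this kit) and the vendored twin `HodgeCM.Vendored.H21.NumberTheory.ComplexMultiplication.ReflexType` (PKG); nothing imports it; install after
`JLiuSignType`; drop alone on bounce).
-/
import Summits.HodgeConjecture.HodgeCM.Model.Binders.JLiuSignType
import Literature.NumberTheory.ComplexMultiplication.EmbeddingAction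
import Literature.NumberTheory.ComplexMultiplication.ReflexType

set_option autoImplicit false

/-!
# The recipe's type `Φ_Ψ` IS Shimura's lifted reflex type `S*` of the corner `(K, Ψ)` — item (J5), group-level half

KERNEL over `Model/Binders/JLiuSignType` (the CM type `SignRecipe.liftType h K L j ι₁ Ψ = {τ ∣ κ^{(h)}(τ) ∈ Ψ}`) and the vendored tree module
`Literature.NumberTheory.ComplexMultiplication.{EmbeddingAction, ReflexType}` ([Shimura1998, §8.1 Prop. 25, §8.3 Prop. 28]: `typeLift`, `reflexLift = S*`,
`reflexField`; the scoped action `ringEquivCompAction` of `Aut(L)` on `K →+* L`).  No new hypothesis kind, nothing cited anew, nothing minted.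

Read the corner type `Ψ ⊆ Hom(K, ℂ)` inside `L` through the distinguished embedding: `Ψ_L := {ψ : K →+* L ∣ ι₁ ∘ ψ ∈ Ψ}` (`pullbackType`).  Then
ON THE AUTOMORPHISM ORBIT OF `ι₁` (all of `Hom(L, ℂ)` when `L/ℚ` is normal):

* `mem_liftType_false_iff_mem_reflexLift` — `ι₁ ∘ g ∈ Φ_Ψ^{(h = false)} ↔ g ∈ S*(Ψ_L, j) = reflexLift Ψ_L j` (`= {g ∣ g⁻¹ ∘ j ∈ Ψ_L}`): PerL v5's
  one-form type `Ψ_t = Φ̃_t⁻¹` (tex l. 100, `φ^h = 1`) is LITERALLY Shimura's `S*` for the corner `(K, Φ_t)` with base point `j` — so that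
  (tree `Literature/NumberTheory/ComplexMultiplication/ReflexPair.lean`, not yet vendored: `reflexType`, `isPrimitive_reflexType`,
  `IsPrimitive.reflexField_reflexType_eq`, `typeLift_reflexType_reflexType`) the REFLEX of `(L, Φ_Ψ)` is `(j(K), Ψ)` for primitive `Ψ` —
  PerL Lemma [lem:reflex] (b), tex ll. 143–149, and exactly the `M'_μ = K` clause that makes [Liu21]'s `A_μ` (Def. 4.3/4.5) a
  `CommonReflexInput c.K (c.Ψ i) c.σ` via `CommonReflexInput.ofInflated` (`Model/CommonReflexOfInflated`);
* `mem_liftType_true_iff_not_mem_reflexLift` — for the other bit, `ι₁ ∘ g ∈ Φ_Ψ^{(h = true)} ↔ g ∉ S*(Ψ_L, j)` (`φ^h = c` is central and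
  `ι₁ ∘ c = \overline{ι₁}`): on the orbit `Φ_Ψ^{(true)}` is the CONJUGATE type of `Φ_Ψ^{(false)}` (`mem_liftType_true_iff_not_mem_liftType_false`);
* `liftType_false_eq_image_reflexLift` — set form under `∀ τ, ∃ g, ι₁ ∘ g = τ` (e.g. `L/ℚ` normal):
  `Φ_Ψ^{(false)} = (g ↦ ι₁ ∘ g) '' S*(Ψ_L, j)`.

0 `proof-hole`, 0 `axiom`; expected `#print axioms` ⊆ {propext, Classical.choice, Quot.sound}.
-/

noncomputable section

open NumberField NumberField.ComplexEmbedding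
open scoped ComplexConjugate
open Literature.AlgebraicGeometry.Motives (CMType)
open Literature.AlgebraicGeometry.ShimuraVarieties (conjRingHomK embedding_conjRingHomK)
open Literature.NumberTheory.ComplexMultiplication

namespace HodgeCM

namespace SignRecipe

open HodgeCM.CMTypeOps (bar mem_bar_iff mem_iff_conjugate_notMem conjugate_mem_iff_notMem)

variable {K L : CMField} (j : K →+* L) (ι₁ : L →+* ℂ)

/-- **The corner type read inside `L`**: `Ψ_L := {ψ : K →+* L ∣ ι₁ ∘ ψ ∈ Ψ}`. [folklore] -/
def pullbackType (Ψ : CMType K) : Set (K →+* L) := {ψ | ι₁.comp ψ ∈ Ψ.1}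

variable {j ι₁}

/-- (Ported verbatim from the HodgeCMPerL package; no docstring in the source.) -/
@[simp] theorem mem_pullbackType_iff (Ψ : CMType K) (ψ : K →+* L) : ψ ∈ pullbackType ι₁ Ψ ↔ ι₁.comp ψ ∈ Ψ.1 := Iff.rfl

/-- `g ∈ S*(Ψ_L, j) ↔ ι₁ ∘ g⁻¹ ∘ j ∈ Ψ` (Shimura's `S*` for the action of `Aut(L)` on `K →+* L`). [folklore] -/
theorem mem_reflexLift_pullbackType_iff (Ψ : CMType K) (g : L ≃+* L) :
    g ∈ (reflexLift (pullbackType ι₁ Ψ) j : Set (L ≃+* L)) ↔ (ι₁.comp g.symm.toRingHom).comp j ∈ Ψ.1 := by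
  rw [mem_reflexLift, mem_pullbackType_iff, ringEquiv_smul_def, ← RingHom.comp_assoc]
  rfl

/-- `g ∈ S(Ψ_L, j) ↔ ι₁ ∘ g ∘ j ∈ Ψ` (Shimura's `S`, the type of `L` INDUCED from `Ψ`). [folklore] -/
theorem mem_typeLift_pullbackType_iff (Ψ : CMType K) (g : L ≃+* L) :
    g ∈ (typeLift (pullbackType ι₁ Ψ) j : Set (L ≃+* L)) ↔ (ι₁.comp g.toRingHom).comp j ∈ Ψ.1 := by
  rw [mem_typeLift, mem_pullbackType_iff, ringEquiv_smul_def, ← RingHom.comp_assoc]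

/-- **`Φ_Ψ^{(false)}` is `S*`**: on the automorphism orbit of `ι₁`, `ι₁ ∘ g ∈ Φ_Ψ ↔ g ∈ reflexLift Ψ_L j`. [folklore] -/
theorem mem_liftType_false_iff_mem_reflexLift (Ψ : CMType K) (g : L ≃+* L) :
    ι₁.comp g.toRingHom ∈ (liftType false K L j ι₁ Ψ).1 ↔ g ∈ (reflexLift (pullbackType ι₁ Ψ) j : Set (L ≃+* L)) := by
  rw [mem_liftType_gal_iff Ψ g rfl, mem_reflexLift_pullbackType_iff, phiH_false, RingHom.comp_id]

/-- **`Φ_Ψ^{(true)}` is the complement of `S*`** on the orbit: `ι₁ ∘ g ∈ Φ_Ψ^{(true)} ↔ g ∉ reflexLift Ψ_L j`. [folklore] -/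
theorem mem_liftType_true_iff_not_mem_reflexLift (Ψ : CMType K) (g : L ≃+* L) :
    ι₁.comp g.toRingHom ∈ (liftType true K L j ι₁ Ψ).1 ↔ g ∉ (reflexLift (pullbackType ι₁ Ψ) j : Set (L ≃+* L)) := by
  rw [mem_liftType_iff, kappa_true_eq_conjugate j g rfl, conjugate_mem_iff_notMem, ← mem_liftType_false_iff_mem_reflexLift,
    mem_liftType_iff]

/-- On the orbit the two bits give CONJUGATE types: `ι₁ ∘ g ∈ Φ_Ψ^{(true)} ↔ ι₁ ∘ g ∉ Φ_Ψ^{(false)}`. [folklore] -/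
theorem mem_liftType_true_iff_not_mem_liftType_false (Ψ : CMType K) (g : L ≃+* L) :
    ι₁.comp g.toRingHom ∈ (liftType true K L j ι₁ Ψ).1 ↔ ι₁.comp g.toRingHom ∉ (liftType false K L j ι₁ Ψ).1 := by
  rw [mem_liftType_true_iff_not_mem_reflexLift, mem_liftType_false_iff_mem_reflexLift]

/-- **Set form** (every embedding on the orbit, e.g. `L/ℚ` normal): `Φ_Ψ^{(false)} = (g ↦ ι₁ ∘ g) '' S*(Ψ_L, j)`. [folklore] -/
theorem liftType_false_eq_image_reflexLift (Ψ : CMType K) (horbit : ∀ τ : L →+* ℂ, ∃ g : L ≃+* L, ι₁.comp g.toRingHom = τ) :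
    (liftType false K L j ι₁ Ψ).1 = (fun g : L ≃+* L => ι₁.comp g.toRingHom) '' (reflexLift (pullbackType ι₁ Ψ) j : Set (L ≃+* L)) := by
  ext τ
  constructor
  · intro hτ
    obtain ⟨g, rfl⟩ := horbit τ
    exact ⟨g, (mem_liftType_false_iff_mem_reflexLift Ψ g).mp hτ, rfl⟩
  · rintro ⟨g, hg, rfl⟩
    exact (mem_liftType_false_iff_mem_reflexLift Ψ g).mpr hg

/-- … and `Φ_Ψ^{(true)} = (g ↦ ι₁ ∘ g) '' (S*)ᶜ = bar Φ_Ψ^{(false)}` on a full orbit. [folklore] -/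
theorem liftType_true_eq_bar_liftType_false (Ψ : CMType K) (horbit : ∀ τ : L →+* ℂ, ∃ g : L ≃+* L, ι₁.comp g.toRingHom = τ) :
    (liftType true K L j ι₁ Ψ).1 = (bar (liftType false K L j ι₁ Ψ)).1 := by
  ext τ
  obtain ⟨g, rfl⟩ := horbit τ
  rw [mem_liftType_true_iff_not_mem_liftType_false, mem_bar_iff]

/-- The base point: `1 ∈ S*(Ψ_L, j) ↔ ι₁ ∘ j ∈ Ψ` — under the guard (`c.σ = ι₁ ∘ j ∈ Ψ_i`) the identity lies in every `S*(Ψ_{i,L}, j)`,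
Shimura's normalisation "`S*` contains the identity". [folklore] -/
theorem one_mem_reflexLift_pullbackType_iff (Ψ : CMType K) :
    (1 : L ≃+* L) ∈ (reflexLift (pullbackType ι₁ Ψ) j : Set (L ≃+* L)) ↔ ι₁.comp j ∈ Ψ.1 := by
  rw [mem_reflexLift, inv_one, one_smul, mem_pullbackType_iff]

end SignRecipe

end HodgeCM

end
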